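import Literature.MathematicalPhysics.QuantumLattice.GrassmannKernelAntisymmetry
import HarnessLib

/-!
# Splitting a Grassmann polynomial by the SUPPORT of its monomials: the part with all legs in a region, and the rest

Topic `MathematicalPhysics/QuantumLattice`; continuation of `GrassmannKernelExpansion` / `GrassmannKernelAntisymmetry`.  For a predicate `P` on labels
(a region of the lattice) and `F = Σ_m Σ_Y kernel F m Y · ψ(Y)`, the SUPPORT PART `supportPart P F := Σ_m Σ_{Y : all Y_j ∈ P} kernel F m Y · ψ(Y)` keeps the
monomials all of whose legs lie in the region; its kernels are `[∀ j, P (Y j)] · kernel F m Y` (the predicate is permutation invariant, so the antisymmetrisation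
of `kernel_presented` is harmless), and the rest `F − supportPart P F` has kernels supported on label families with a leg OUTSIDE the region.  Used to split
the difference of two volumes' effective actions into a globally small part (all legs deep) and a part touching the boundary zone
(`GrassmannZoneLipschitzDB`).  (Salmhofer 1999, §4.3 (4.95): the kernel expansion; the split itself is bookkeeping.)

* `supportPart`, `kernel_eq_zero_of_card_lt`, **`kernel_supportPart`**, `kernel_sub_supportPart`, `exists_not_of_kernel_sub_supportPart_ne_zero`,
  `sum_filter_norm_kernel_supportPart_mul_le` / `…_eq_zero_of_not` (pinned profiles: dominated by those of `F`, and zero at pins outside the region),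
  `supportPart_mem_evenPart`, `constPart_supportPart`.

## Sources
M. Salmhofer, *Renormalization: An Introduction* (Springer 1999), §4.3 (4.95) [`Salmhofer1999`].
-/

noncomputable section

namespace Literature.MathematicalPhysics.QuantumLattice

open GrassmannAlgebra Finset

variable (R : Type*) [CommRing R] [Algebra ℚ R] {Γ : Type*} [Fintype Γ] [DecidableEq Γ]

/-- The **support part** of `F` on the region `P`: the monomials all of whose legs satisfy `P`, with their kernels. [cite: Salmhofer1999, §4.3 (4.95)] -/
def supportPart (P : Γ → Prop) [DecidablePred P] (F : GrassmannAlgebra R Γ) : GrassmannAlgebra R Γ :=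
  ∑ m ∈ range (Fintype.card Γ + 1), presented R (fun X : Fin m → Γ => if ∀ j, P (X j) then kernel R F m X else 0)

/-- Kernels vanish above the number of labels. [cite: Salmhofer1999, §4.3 (4.95)] -/
theorem kernel_eq_zero_of_card_lt (F : GrassmannAlgebra R Γ) {m : ℕ} (hm : Fintype.card Γ < m) (X : Fin m → Γ) : kernel R F m X = 0 := by
  conv_lhs => rw [eq_sum_presented_kernel R F]
  rw [kernel_sum]
  exact sum_eq_zero fun k hk => kernel_presented_of_ne R _ X (by have := mem_range.1 hk; omega)

/-- **The kernels of the support part**: `kernel (supportPart P F) m X = [∀ j, P (X j)] · kernel F m X`. [cite: Salmhofer1999, §4.3 (4.95)] -/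
theorem kernel_supportPart (P : Γ → Prop) [DecidablePred P] (F : GrassmannAlgebra R Γ) (m : ℕ) (X : Fin m → Γ) :
    kernel R (supportPart R P F) m X = if ∀ j, P (X j) then kernel R F m X else 0 := by
  rw [supportPart, kernel_sum]
  by_cases hm : m ∈ range (Fintype.card Γ + 1)
  · rw [sum_eq_single_of_mem m hm (fun k _ hk => kernel_presented_of_ne R _ X (Ne.symm hk)), kernel_presented]
    have hc : ((m.factorial : ℚ)⁻¹ • (1 : R)) * ((m.factorial : ℕ) : R) = 1 := by
      rw [← mul_one ((m.factorial : ℕ) : R), ← nsmul_eq_mul, ← Nat.cast_smul_eq_nsmul ℚ, smul_mul_smul_comm,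
        one_mul, inv_mul_cancel₀ (by positivity), one_smul]
    -- the predicate is permutation invariant and the kernel is antisymmetric
    have hσ : ∀ σ : Equiv.Perm (Fin m), Equiv.Perm.sign σ • (fun X : Fin m → Γ => if ∀ j, P (X j) then kernel R F m X else 0) (X ∘ σ) =
        if ∀ j, P (X j) then kernel R F m X else 0 := by
      intro σ
      by_cases h : ∀ j, P (X j)
      · have h' : ∀ j, P ((X ∘ σ) j) := fun j => h (σ j)
        simp only [if_pos h', if_pos h]
        rw [kernel_comp_perm R F m X σ, Units.smul_def, zsmul_eq_mul, ← mul_assoc, ← Int.cast_mul, Int.units_coe_mul_self, Int.cast_one,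
          one_mul]
      · have h' : ¬ ∀ j, P ((X ∘ σ) j) := fun h'' => h fun j => by simpa using h'' (σ.symm j)
        simp only [if_neg h', if_neg h, smul_zero]
    rw [sum_congr rfl fun σ _ => hσ σ, sum_const, card_univ, Fintype.card_perm, Fintype.card_fin, nsmul_eq_mul, ← mul_assoc, hc, one_mul]
  · have hlt : Fintype.card Γ < m := by rw [mem_range] at hm; omega
    rw [sum_eq_zero fun k hk => kernel_presented_of_ne R _ X (by rintro rfl; exact hm hk), kernel_eq_zero_of_card_lt R F hlt, ite_self]

/-- The kernels of the REST `F − supportPart P F`: `[¬ ∀ j, P (X j)] · kernel F m X`. [cite: Salmhofer1999, §4.3 (4.95)] -/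
theorem kernel_sub_supportPart (P : Γ → Prop) [DecidablePred P] (F : GrassmannAlgebra R Γ) (m : ℕ) (X : Fin m → Γ) :
    kernel R (F - supportPart R P F) m X = if ∀ j, P (X j) then 0 else kernel R F m X := by
  rw [sub_eq_add_neg, kernel_add, show -supportPart R P F = (-1 : R) • supportPart R P F from (neg_one_smul R _).symm, kernel_smul,
    kernel_supportPart]
  split_ifs <;> ring

/-- **Every kernel of the rest has a leg outside the region.** [cite: Salmhofer1999, §4.3 (4.95)] -/
theorem exists_not_of_kernel_sub_supportPart_ne_zero (P : Γ → Prop) [DecidablePred P] (F : GrassmannAlgebra R Γ) {m : ℕ} {X : Fin m → Γ}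
    (h : kernel R (F - supportPart R P F) m X ≠ 0) : ∃ j, ¬ P (X j) := by
  by_contra hne
  push Not at hne
  rw [kernel_sub_supportPart, if_pos hne] at h
  exact h rfl

/-- The support part of an even element is even. [cite: Salmhofer1999, §4.3 (4.95)] -/
theorem supportPart_mem_evenPart (P : Γ → Prop) [DecidablePred P] {F : GrassmannAlgebra R Γ} (hF : F ∈ evenPart R Γ) :
    supportPart R P F ∈ evenPart R Γ := by
  refine Subalgebra.sum_mem _ fun m _ => ?_
  rcases Nat.even_or_odd m with he | ho
  · refine Submodule.sum_mem _ fun Y _ => Submodule.smul_mem _ _ ?_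
    have h := genProd_mem_evenOdd R Y
    rwa [(ZMod.natCast_eq_zero_iff_even).2 he] at h
  · have h0 : (fun X : Fin m → Γ => if ∀ j, P (X j) then kernel R F m X else 0) = 0 :=
      funext fun X => by simp [kernel_eq_zero_of_mem_evenPart_of_odd R hF ho X]
    rw [h0, presented_zero]
    exact zero_mem _

/-- The constant part of the support part is that of `F`. [cite: Salmhofer1999, §4.3 (4.95)] -/
theorem constPart_supportPart (P : Γ → Prop) [DecidablePred P] (F : GrassmannAlgebra R Γ) :
    constPart R (supportPart R P F) = constPart R F := by
  rw [← kernel_zero R (supportPart R P F) Fin.elim0, kernel_supportPart, if_pos fun j => Fin.elim0 j, kernel_zero]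

section Norms

variable {𝕜 : Type*} [RCLike 𝕜]

/-- **Pinned weighted profiles of the support part are dominated by those of `F`.** [cite: Salmhofer1999, §4.3 (4.95)] -/
theorem sum_filter_norm_kernel_supportPart_mul_le (P : Γ → Prop) [DecidablePred P] (F : GrassmannAlgebra 𝕜 Γ) (m : ℕ) (j : Fin m) (x : Γ)
    (wt : (Fin m → Γ) → ℝ) (hwt : ∀ Y, 0 ≤ wt Y) :
    ∑ Y ∈ univ.filter (fun Y : Fin m → Γ => Y j = x), ‖kernel 𝕜 (supportPart 𝕜 P F) m Y‖ * wt Y ≤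
      ∑ Y ∈ univ.filter (fun Y : Fin m → Γ => Y j = x), ‖kernel 𝕜 F m Y‖ * wt Y := by
  refine sum_le_sum fun Y _ => mul_le_mul_of_nonneg_right ?_ (hwt Y)
  rw [kernel_supportPart]
  split_ifs
  · exact le_rfl
  · rw [norm_zero]; exact norm_nonneg _

/-- **The support part has no profile at pins outside the region.** [cite: Salmhofer1999, §4.3 (4.95)] -/
theorem sum_filter_norm_kernel_supportPart_eq_zero_of_not (P : Γ → Prop) [DecidablePred P] (F : GrassmannAlgebra 𝕜 Γ) (m : ℕ) (j : Fin m)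
    {x : Γ} (hx : ¬ P x) (wt : (Fin m → Γ) → ℝ) :
    ∑ Y ∈ univ.filter (fun Y : Fin m → Γ => Y j = x), ‖kernel 𝕜 (supportPart 𝕜 P F) m Y‖ * wt Y = 0 := by
  refine sum_eq_zero fun Y hY => ?_
  rw [kernel_supportPart, if_neg (fun h => hx (by rw [← (mem_filter.1 hY).2]; exact h j)), norm_zero, zero_mul]

/-- **Pinned weighted profiles of the rest are dominated by those of `F`.** [cite: Salmhofer1999, §4.3 (4.95)] -/
theorem sum_filter_norm_kernel_sub_supportPart_mul_le (P : Γ → Prop) [DecidablePred P] (F : GrassmannAlgebra 𝕜 Γ) (m : ℕ) (j : Fin m) (x : Γ)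
    (wt : (Fin m → Γ) → ℝ) (hwt : ∀ Y, 0 ≤ wt Y) :
    ∑ Y ∈ univ.filter (fun Y : Fin m → Γ => Y j = x), ‖kernel 𝕜 (F - supportPart 𝕜 P F) m Y‖ * wt Y ≤
      ∑ Y ∈ univ.filter (fun Y : Fin m → Γ => Y j = x), ‖kernel 𝕜 F m Y‖ * wt Y := by
  refine sum_le_sum fun Y _ => mul_le_mul_of_nonneg_right ?_ (hwt Y)
  rw [kernel_sub_supportPart]
  split_ifs
  · rw [norm_zero]; exact norm_nonneg _
  · exact le_rfl

end Norms

end Literature.MathematicalPhysics.QuantumLattice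

end
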